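import Mathlib.Analysis.Calculus.InverseFunctionTheorem.ContDiff
import Mathlib.Analysis.Calculus.ContDiff.Operations
import Mathlib.Analysis.Normed.Operator.Banach
import Mathlib.Analysis.Normed.Ring.Units
import HarnessLib

/-!
# A normalising change of coordinates: straightening two smooth families of fibre
# isomorphisms along two complementary coordinate planes

Topic `Literature/Topology/FourManifolds` (fact seat
`provefact-Literature.Topology.FourManifolds.Matvey-69322e0896`, rung (H4)
`Literature.Topology.FourManifolds.Matveyev1996_partOne_and_fact_of_dualSpheres`;
infrastructure for the adapted chart at a crossing of the middle-level configuration,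
`PlumbingAdaptedChart.lean`, `PlumbingFibreDerivative.lean`).  In a splitting chart
`E × F` about a crossing the two spheres are the planes `{Y = 0}` and `{X = 0}`, and the
fibre derivatives of the two tubes read in the chart are smooth families of isomorphisms
`B(X) : F ≅ F` along the first plane and `Γ(Y) : E ≅ E` along the second.  The change of
coordinates `G(X, Y) = (Γ(Y)⁻¹ X, B(X)⁻¹ Y)` preserves both planes, is a local
diffeomorphism at the origin (its derivative there is `Γ(0)⁻¹ × B(0)⁻¹`), and makes both
fibre derivatives the identity (sequel).  Everything here is elementary calculus on normed
spaces and is proved; there are no definitions and no named facts: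

* `Literature.Topology.FourManifolds.contDiffOn_inverse_of_bijective` — for a `C^∞` family
  `B : U → (F →L F)` of bijective maps (`F` finite-dimensional over `ℝ`... here: complete,
  with bijectivity upgraded by the open mapping theorem), `X ↦ B(X)⁻¹`
  (`ContinuousLinearMap.inverse`) is `C^∞` on `U`, and `B(X)⁻¹ ∘ B(X) = id`,
  `B(X) ∘ B(X)⁻¹ = id`;
* `Literature.Topology.FourManifolds.exists_normalisingChartChange` — **the local
  diffeomorphism `G`**: an open partial homeomorphism `G` of `E × F` with `(0, 0)` in its
  source, source inside `U × W`, `G = (Γ(Y)⁻¹ X, B(X)⁻¹ Y)` on the source, `C^∞` with `C^∞`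
  inverse on source and target, `G(0, 0) = (0, 0)`, and `(G p).1 = 0 ↔ p.1 = 0`,
  `(G p).2 = 0 ↔ p.2 = 0` (the inverse function theorem,
  `ContDiffAt.toOpenPartialHomeomorph`, the source shrunk to where `dG` is invertible so that
  `OpenPartialHomeomorph.contDiffAt_symm` applies at every point of the target).

## References

* J. M. Lee, *Introduction to Smooth Manifolds*, 2nd ed., GTM 218 (2013), Thm. 4.5 (inverse
  function theorem), Prop. 5.2. [LeeSmoothManifolds2013]
* M. W. Hirsch, *Differential Topology*, GTM 33 (1976), Ch. 4 §5. [HirschDT1976]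
* S. Lang, *Fundamentals of Differential Geometry*, GTM 191 (1999), Ch. I §5, Ch. IV §5.
-/

open Set Function Metric
open scoped Topology ContDiff

noncomputable section

namespace Literature.Topology.FourManifolds

section Inverse

variable {E F : Type*} [NormedAddCommGroup E] [NormedSpace ℝ E] [NormedAddCommGroup F]
  [NormedSpace ℝ F] [CompleteSpace F]

/-- **A smooth family of bijective continuous linear maps has a smooth family of inverses.**
If `B : E → (F →L F)` is `C^∞` on an open set `U` and every `B X`, `X ∈ U`, is bijective (so
a linear homeomorphism, `F` being complete), then `X ↦ (B X).inverse` is `C^∞` on `U`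
(`contDiffAt_map_inverse`), and `(B X).inverse` is the two-sided inverse of `B X`. [folklore] -/
theorem contDiffOn_inverse_of_bijective {B : E → F →L[ℝ] F} {U : Set E}
    (hB : ContDiffOn ℝ ∞ B U) (hbij : ∀ X ∈ U, Bijective (B X)) :
    ContDiffOn ℝ ∞ (fun X => (B X).inverse) U ∧
      ∀ X ∈ U, ((B X).inverse.comp (B X) = ContinuousLinearMap.id ℝ F ∧
        (B X).comp (B X).inverse = ContinuousLinearMap.id ℝ F) := by
  have hequiv : ∀ X ∈ U, ∃ e : F ≃L[ℝ] F, (e : F →L[ℝ] F) = B X := fun X hX =>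
    ⟨ContinuousLinearEquiv.ofBijective (B X) (LinearMap.ker_eq_bot.2 (hbij X hX).1)
      (LinearMap.range_eq_top.2 (hbij X hX).2), ContinuousLinearEquiv.coe_ofBijective _ _ _⟩
  refine ⟨fun X hX => ?_, fun X hX => ?_⟩
  · obtain ⟨e, he⟩ := hequiv X hX
    have h1 : ContDiffAt ℝ ∞ ContinuousLinearMap.inverse (B X) := by
      rw [← he]
      exact contDiffAt_map_inverse e
    exact h1.comp_contDiffWithinAt X (hB X hX)
  · obtain ⟨e, he⟩ := hequiv X hX
    rw [← he, ContinuousLinearMap.inverse_equiv]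
    exact ⟨by ext v; simp, by ext v; simp⟩

end Inverse

section Normalise

variable {E F : Type*} [NormedAddCommGroup E] [NormedSpace ℝ E] [CompleteSpace E]
  [NormedAddCommGroup F] [NormedSpace ℝ F] [CompleteSpace F]

/-- **The normalising change of coordinates.**  Let `B : E → (F →L F)` be `C^∞` on an open
`U ∋ 0` with every `B X` bijective, and `Γ : F → (E →L E)` be `C^∞` on an open `W ∋ 0` with
every `Γ Y` bijective.  Then `G(X, Y) = (Γ(Y)⁻¹ X, B(X)⁻¹ Y)` is, near the origin, a `C^∞`
local diffeomorphism: there is an open partial homeomorphism `G` of `E × F`, with `(0, 0)`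
in its source, source contained in `U × W`, given by that formula on its source, `C^∞` on
the source with `C^∞` inverse on the target, fixing the origin, and preserving the two
coordinate planes: `(G p).1 = 0 ↔ p.1 = 0`, `(G p).2 = 0 ↔ p.2 = 0` for `p` in the source.
(Derivative at the origin `Γ(0)⁻¹ × B(0)⁻¹`: the cross terms vanish because the families
are applied to the vanishing coordinate; inverse function theorem; the source is shrunk to
the open set where `dG` is invertible, so that the inverse is `C^∞` at every point of the
target.) [cite: LeeSmoothManifolds2013, Thm. 4.5 (inverse function theorem) and Prop. 5.2] -/
theorem exists_normalisingChartChange {B : E → F →L[ℝ] F} {U : Set E} (hU : IsOpen U)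
    (h0U : (0 : E) ∈ U) (hB : ContDiffOn ℝ ∞ B U) (hBbij : ∀ X ∈ U, Bijective (B X))
    {Γ : F → E →L[ℝ] E} {W : Set F} (hW : IsOpen W) (h0W : (0 : F) ∈ W)
    (hΓ : ContDiffOn ℝ ∞ Γ W) (hΓbij : ∀ Y ∈ W, Bijective (Γ Y)) :
    ∃ G : OpenPartialHomeomorph (E × F) (E × F),
      (0, 0) ∈ G.source ∧ G.source ⊆ U ×ˢ W ∧
      (∀ p ∈ G.source, G p = ((Γ p.2).inverse p.1, (B p.1).inverse p.2)) ∧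
      ContDiffOn ℝ ∞ G G.source ∧ ContDiffOn ℝ ∞ G.symm G.target ∧
      G (0, 0) = (0, 0) ∧
      (∀ p ∈ G.source, (G p).1 = 0 ↔ p.1 = 0) ∧ (∀ p ∈ G.source, (G p).2 = 0 ↔ p.2 = 0) := by
  obtain ⟨hBinv, hBid⟩ := contDiffOn_inverse_of_bijective hB hBbij
  obtain ⟨hΓinv, hΓid⟩ := contDiffOn_inverse_of_bijective hΓ hΓbij
  -- the map `G₀` on all of `E × F` (junk off `U × W`)
  set G₀ : E × F → E × F := fun p => ((Γ p.2).inverse p.1, (B p.1).inverse p.2) with hG₀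
  have hΩ : IsOpen (U ×ˢ W) := hU.prod hW
  have h0Ω : ((0 : E), (0 : F)) ∈ U ×ˢ W := ⟨h0U, h0W⟩
  -- smoothness of `G₀` on `U × W`
  have hG₀s : ContDiffOn ℝ ∞ G₀ (U ×ˢ W) := by
    have h1 : ContDiffOn ℝ ∞ (fun p : E × F => (Γ p.2).inverse p.1) (U ×ˢ W) :=
      (hΓinv.comp contDiffOn_snd fun p hp => hp.2).clm_apply contDiffOn_fst
    have h2 : ContDiffOn ℝ ∞ (fun p : E × F => (B p.1).inverse p.2) (U ×ˢ W) :=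
      (hBinv.comp contDiffOn_fst fun p hp => hp.1).clm_apply contDiffOn_snd
    exact h1.prodMk h2
  have hG₀at : ContDiffAt ℝ ∞ G₀ (0, 0) := hG₀s.contDiffAt (hΩ.mem_nhds h0Ω)
  -- the derivative at the origin: `Γ(0)⁻¹ × B(0)⁻¹`
  obtain ⟨eB, heB⟩ : ∃ e : F ≃L[ℝ] F, (e : F →L[ℝ] F) = B 0 :=
    ⟨ContinuousLinearEquiv.ofBijective (B 0) (LinearMap.ker_eq_bot.2 (hBbij 0 h0U).1)
      (LinearMap.range_eq_top.2 (hBbij 0 h0U).2), ContinuousLinearEquiv.coe_ofBijective _ _ _⟩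
  obtain ⟨eΓ, heΓ⟩ : ∃ e : E ≃L[ℝ] E, (e : E →L[ℝ] E) = Γ 0 :=
    ⟨ContinuousLinearEquiv.ofBijective (Γ 0) (LinearMap.ker_eq_bot.2 (hΓbij 0 h0W).1)
      (LinearMap.range_eq_top.2 (hΓbij 0 h0W).2), ContinuousLinearEquiv.coe_ofBijective _ _ _⟩
  have hBinv0 : (B 0).inverse = (eB.symm : F →L[ℝ] F) := by
    rw [← heB, ContinuousLinearMap.inverse_equiv]
  have hΓinv0 : (Γ 0).inverse = (eΓ.symm : E →L[ℝ] E) := by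
    rw [← heΓ, ContinuousLinearMap.inverse_equiv]
  set L : (E × F) ≃L[ℝ] (E × F) := eΓ.symm.prodCongr eB.symm with hL
  have hderiv : HasFDerivAt G₀ (L : E × F →L[ℝ] E × F) ((0 : E), (0 : F)) := by
    -- first component
    have hc₁ : HasFDerivAt (fun p : E × F => (Γ p.2).inverse)
        ((fderiv ℝ (fun Y => (Γ Y).inverse) 0).comp (ContinuousLinearMap.snd ℝ E F))
        ((0 : E), (0 : F)) := by
      have hd : DifferentiableAt ℝ (fun Y => (Γ Y).inverse) ((fun p : E × F => p.2) (0, 0)) :=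
        (hΓinv.contDiffAt (hW.mem_nhds h0W)).differentiableAt (by simp)
      exact hd.hasFDerivAt.comp ((0 : E), (0 : F)) hasFDerivAt_snd
    have h₁ := hc₁.clm_apply
      (hasFDerivAt_fst (𝕜 := ℝ) (E := E) (F := F) (p := ((0 : E), (0 : F))))
    -- second component
    have hc₂ : HasFDerivAt (fun p : E × F => (B p.1).inverse)
        ((fderiv ℝ (fun X => (B X).inverse) 0).comp (ContinuousLinearMap.fst ℝ E F))
        ((0 : E), (0 : F)) := by
      have hd : DifferentiableAt ℝ (fun X => (B X).inverse) ((fun p : E × F => p.1) (0, 0)) :=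
        (hBinv.contDiffAt (hU.mem_nhds h0U)).differentiableAt (by simp)
      exact hd.hasFDerivAt.comp ((0 : E), (0 : F)) hasFDerivAt_fst
    have h₂ := hc₂.clm_apply
      (hasFDerivAt_snd (𝕜 := ℝ) (E := E) (F := F) (p := ((0 : E), (0 : F))))
    have h := h₁.prodMk h₂
    refine h.congr_fderiv (ContinuousLinearMap.ext fun p => ?_)
    obtain ⟨X, Y⟩ := p
    have hRHS : (L : E × F →L[ℝ] E × F) (X, Y) = (eΓ.symm X, eB.symm Y) := rfl
    rw [hRHS]
    refine Prod.ext ?_ ?_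
    · show (Γ (0 : F)).inverse X + (fderiv ℝ (fun Y => (Γ Y).inverse) 0 Y) (0 : E) = eΓ.symm X
      rw [map_zero, add_zero, hΓinv0]
      rfl
    · show (B (0 : E)).inverse Y + (fderiv ℝ (fun X => (B X).inverse) 0 X) (0 : F) = eB.symm Y
      rw [map_zero, add_zero, hBinv0]
      rfl
  -- the inverse function theorem
  set G₁ := hG₀at.toOpenPartialHomeomorph G₀ hderiv (by simp) with hG₁
  have hG₁coe : (G₁ : E × F → E × F) = G₀ := ContDiffAt.toOpenPartialHomeomorph_coe _ hderiv _
  have h0src₁ : ((0 : E), (0 : F)) ∈ G₁.source :=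
    ContDiffAt.mem_toOpenPartialHomeomorph_source _ hderiv _
  -- shrink the source: inside `U × W` and where `dG₀` is invertible
  set V : Set (E × F) := {p ∈ U ×ˢ W | IsUnit (fderiv ℝ G₀ p)} with hV
  have hVo : IsOpen V := by
    have hc : ContinuousOn (fderiv ℝ G₀) (U ×ˢ W) := hG₀s.continuousOn_fderiv_of_isOpen hΩ (by simp)
    exact hc.isOpen_inter_preimage hΩ Units.isOpen
  have h0V : ((0 : E), (0 : F)) ∈ V := by
    refine ⟨h0Ω, ?_⟩
    rw [hderiv.fderiv]
    exact ⟨(ContinuousLinearEquiv.unitsEquiv ℝ (E × F)).symm L, rfl⟩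
  set G := G₁.restrOpen V hVo with hG
  have hGcoe : (G : E × F → E × F) = G₀ := hG₁coe
  have hGsrc : G.source = G₁.source ∩ V := rfl
  have hGsrc_sub : G.source ⊆ V := inter_subset_right
  refine ⟨G, ⟨h0src₁, h0V⟩, fun p hp => (hGsrc_sub hp).1, fun p _ => by rw [hGcoe], ?_, ?_, ?_,
    ?_, ?_⟩
  · -- smooth on the source
    rw [hGcoe]
    exact hG₀s.mono fun p hp => (hGsrc_sub hp).1
  · -- smooth inverse on the target: invertible derivative at every point of the source
    intro q hq
    have hq' : G.symm q ∈ G.source := G.map_target hq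
    obtain ⟨hpΩ, hunit⟩ := hGsrc_sub hq'
    obtain ⟨u, hu⟩ := hunit
    set e : (E × F) ≃L[ℝ] (E × F) := ContinuousLinearEquiv.unitsEquiv ℝ (E × F) u with he
    have hecoe : (e : E × F →L[ℝ] E × F) = fderiv ℝ G₀ (G.symm q) := by
      rw [← hu]
      rfl
    have hdiff : HasFDerivAt G (e : E × F →L[ℝ] E × F) (G.symm q) := by
      rw [hGcoe, hecoe]
      exact ((hG₀s.differentiableOn (by simp)).differentiableAt (hΩ.mem_nhds hpΩ)).hasFDerivAt
    have hsm : ContDiffAt ℝ ∞ G (G.symm q) := by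
      rw [hGcoe]
      exact hG₀s.contDiffAt (hΩ.mem_nhds hpΩ)
    exact (G.contDiffAt_symm hq hdiff hsm).contDiffWithinAt
  · -- the origin is fixed
    rw [hGcoe]
    show ((Γ 0).inverse 0, (B 0).inverse 0) = (0, 0)
    rw [map_zero, map_zero]
  · -- the plane `{X = 0}` is preserved
    intro p hp
    rw [hGcoe]
    show (Γ p.2).inverse p.1 = 0 ↔ p.1 = 0
    have hp2 : p.2 ∈ W := ((hGsrc_sub hp).1).2
    obtain ⟨h1, h2⟩ := hΓid p.2 hp2
    constructor
    · intro h
      have := congrArg (Γ p.2) h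
      rwa [map_zero, ← ContinuousLinearMap.comp_apply, h2, ContinuousLinearMap.id_apply] at this
    · intro h
      rw [h, map_zero]
  · -- the plane `{Y = 0}` is preserved
    intro p hp
    rw [hGcoe]
    show (B p.1).inverse p.2 = 0 ↔ p.2 = 0
    have hp1 : p.1 ∈ U := ((hGsrc_sub hp).1).1
    obtain ⟨h1, h2⟩ := hBid p.1 hp1
    constructor
    · intro h
      have := congrArg (B p.1) h
      rwa [map_zero, ← ContinuousLinearMap.comp_apply, h2, ContinuousLinearMap.id_apply] at this
    · intro h
      rw [h, map_zero]

end Normalise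

end Literature.Topology.FourManifolds

end
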